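import Summits.KontsevichZagierPeriods.Zeta5Search.TwoTaleOmega.FormalBarnes
import Literature.NumberTheory.Irrationality.Zudilin2014.FirstTaleNewton
import Literature.NumberTheory.Irrationality.Zudilin2014.FirstTaleScaling

/-!
# Formal Barnes functionals III — the LINK with Zudilin's first-tale forms (cell `pub-zeta5`, fam-tele gen 4)

HONEST FRAMING: systematic search; no irrationality claim unless certified.

OUR infrastructure (Summit side), blueprint `families/tele/RECURRENCE.md §13.2 (LINK)`.  The first-tale rational
function has the partial-fraction expansion `R(t) = P(t) + Σ_{k ∈ [a_max, b₃)} C_k/(t+k)`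
(`Zudilin2014.R_eq_polyP_add_polar`); its DATA is `dataR a b : PF`.  Evaluating the formal functional of
`FormalBarnes` at the first-tale node `s = 1 − a₂*` (contour `Re t = 1/2 − a₂*`, all poles to its left… i.e. every
`m = k − a₂* ≥ 0`) and unfolding gives LITERALLY Zudilin's forms:
  `(−1)^d · lam1 (1 − a₂*) (dataR a b) = formQ a b`,   `(−1)^d · lam0 d (1 − a₂*) (dataR a b) = − formP a b`
(`link_formQ`, `link_formP`, `d = dExp a b`) — no analysis, no named fact: the functional was DEFINED to make this
an unfolding (`coefA_eq_fwdDiff` for the polynomial part, `H2 = harmTwo` for the polar part).  Consequently any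
formal telescoping identity between data (`FormalBarnes.lam•_telescope`) is an identity between `formP/formQ`
values — the kernel route to the p-half of `(bmiss)` (§13.3–13.6), whose remaining inputs are the Ω-closure
identities (cert lanes, `Certificates/PolyKronecker6`) and partial-fraction uniqueness.
-/

noncomputable section

open Polynomial Finset fwdDiff
open Literature.NumberTheory.Irrationality.Zudilin2014

namespace Summit.KontsevichZagierPeriods.Zeta5Search.FormalBarnes

/-- `H₂` is the tree's `harmTwo` (definitionally). -/
theorem H2_eq_harmTwo (m : ℕ) : H2 m = harmTwo m := rfl

/-- The weight `φ⁰` on the `+` side (`m ≥ 0`) is `−H₂(m)`. -/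
theorem phi0_of_nonneg {m : ℤ} (h : 0 ≤ m) : phi0 m = -H2 m.toNat := by
  obtain ⟨n, rfl⟩ := Int.eq_ofNat_of_zero_le h
  rfl

/-- The weight `φ¹` on the `+` side (`m ≥ 0`) is `1`. -/
theorem phi1_of_nonneg {m : ℤ} (h : 0 ≤ m) : phi1 m = 1 := by
  obtain ⟨n, rfl⟩ := Int.eq_ofNat_of_zero_le h
  rfl

/-- The weight `φ⁰` on the `−` side (`m < 0`) is `+H₂(−m−1)` (reflection rule). -/
theorem phi0_of_neg {m : ℤ} (h : m < 0) : phi0 m = H2 (-m - 1).toNat := by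
  obtain ⟨n, rfl⟩ := Int.eq_negSucc_of_lt_zero h
  have : (-Int.negSucc n - 1).toNat = n := by rw [Int.negSucc_eq]; omega
  rw [this]
  rfl

/-- The weight `φ¹` on the `−` side (`m < 0`) is `−1` (reflection rule). -/
theorem phi1_of_neg {m : ℤ} (h : m < 0) : phi1 m = -1 := by
  obtain ⟨n, rfl⟩ := Int.eq_negSucc_of_lt_zero h
  rfl

/-- The double-pole weight `ψ⁰(m) = −2H₃` of the reflected index, on both sides. -/
theorem psi0_eq (m : ℤ) : psi0 m = -2 * H3 (if 0 ≤ m then m.toNat else (-m - 1).toNat) := by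
  rcases m with n | n
  · simp [psi0]
  · have h : ¬ (0 : ℤ) ≤ Int.negSucc n := by simp [Int.negSucc_eq]; omega
    have : (-Int.negSucc n - 1).toNat = n := by rw [Int.negSucc_eq]; omega
    simp only [psi0, if_neg h, this]

/-- Summing a function against finitely many `Finsupp.single`s. -/
theorem sum_singles {S : Finset ℤ} {c : ℤ → ℚ} {h : ℤ → ℚ → ℚ} (h0 : ∀ k, h k 0 = 0)
    (hadd : ∀ k x y, h k (x + y) = h k x + h k y) :
    (∑ k ∈ S, Finsupp.single k (c k)).sum h = ∑ k ∈ S, h k (c k) := by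
  rw [← Finsupp.sum_finsetSum_index h0 hadd]
  exact Finset.sum_congr rfl fun k _ => Finsupp.sum_single_index (h0 k)

variable (a b : Fin 4 → ℤ)

/-- The first-tale partial-fraction DATA of `R(t) = R(a,b;t)`: polynomial part `polyP a b`, simple parts
`C_k/(t+k)`, `k ∈ [a_max, b₃)`, no double parts. -/
def dataR : PF := ⟨polyP a b, ∑ k ∈ Ico (amax a) (b 3), Finsupp.single k (coefC a b k), 0⟩

/-- The data evaluate to `R` (away from the poles; `Admissible` as in `R_eq_polyP_add_polar`). -/
theorem dataR_eval {a b : Fin 4 → ℤ} (h : Admissible a b) {t : ℚ} (ht : ∀ k ∈ Ico (a 3) (b 3), t + k ≠ 0) :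
    (dataR a b).eval t = R a b t := by
  rw [R_eq_polyP_add_polar h ht]
  unfold PF.eval dataR
  simp only
  rw [sum_singles (fun _ => by simp) (fun _ _ _ => by ring), Finsupp.sum_zero_index, add_zero]

/-- Polynomial part of the LINK: `lamPoly` at the node `1 − a₂*` is the `A_ℓ`-sum of `formP`. -/
theorem lamPoly_polyP (d : ℕ) :
    lamPoly d (((1 - a2star a : ℤ) : ℚ)) (polyP a b) = ∑ ℓ ∈ range (d + 1), (-1) ^ ℓ * coefA a b ℓ / (ℓ + 1) := by
  unfold lamPoly
  refine Finset.sum_congr rfl fun ℓ _ => ?_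
  have hf : (fun t : ℚ => (polyP a b).eval (t - a2star a))
      = fun r => (fun u => (polyP a b).eval u) (r + (-(a2star a : ℚ))) := by
    funext t; simp [sub_eq_add_neg]
  rw [coefA_eq_fwdDiff, hf, fwdDiff_iter_comp_add (1 : ℚ) (fun u => (polyP a b).eval u) (-(a2star a : ℚ)) ℓ 1]
  push_cast
  rw [sub_eq_add_neg]

/-- Polar part of the LINK, `ζ(2)`-coordinate: every pole of `R` lies on the `+` side of the first-tale node. -/
theorem lam1_dataR : lam1 (1 - a2star a) (dataR a b) = ∑ k ∈ Ico (amax a) (b 3), coefC a b k := by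
  unfold lam1 dataR
  simp only
  rw [sum_singles (fun _ => by simp) (fun _ _ _ => by ring)]
  refine Finset.sum_congr rfl fun k hk => ?_
  have hk0 : 0 ≤ k - a2star a := by have := (mem_Ico.1 hk).1; have := a2star_le_amax a; linarith
  rw [show k + (1 - a2star a) - 1 = k - a2star a by ring, phi1_of_nonneg hk0, mul_one]

/-- Polar + polynomial part of the LINK, `e₀`-coordinate. -/
theorem lam0_dataR (d : ℕ) :
    lam0 d (1 - a2star a) (dataR a b) = ∑ ℓ ∈ range (d + 1), (-1) ^ ℓ * coefA a b ℓ / (ℓ + 1)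
      - ∑ k ∈ Ico (amax a) (b 3), coefC a b k * harmTwo (k - a2star a).toNat := by
  unfold lam0 dataR
  simp only
  rw [lamPoly_polyP, sum_singles (fun _ => by simp) (fun _ _ _ => by ring), Finsupp.sum_zero_index, add_zero]
  have hs : ∑ k ∈ Ico (amax a) (b 3), coefC a b k * phi0 (k + (1 - a2star a) - 1)
      = -∑ k ∈ Ico (amax a) (b 3), coefC a b k * harmTwo (k - a2star a).toNat := by
    rw [← sum_neg_distrib]
    refine Finset.sum_congr rfl fun k hk => ?_
    have hk0 : 0 ≤ k - a2star a := by have := (mem_Ico.1 hk).1; have := a2star_le_amax a; linarith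
    rw [show k + (1 - a2star a) - 1 = k - a2star a by ring, phi0_of_nonneg hk0, H2_eq_harmTwo]
    ring
  rw [hs]
  ring

/-- **LINK, `ζ(2)`-coordinate**: `(−1)^d Λ¹_{1−a₂*}[data R] = Q(a,b)` by unfolding. -/
theorem link_formQ : (-1) ^ dExp a b * lam1 (1 - a2star a) (dataR a b) = formQ a b := by
  rw [lam1_dataR]; rfl

/-- **LINK, `e₀`-coordinate**: `(−1)^d Λ⁰_{1−a₂*}[data R] = −P(a,b)` by unfolding (`d = dExp a b`). -/
theorem link_formP : (-1) ^ dExp a b * lam0 (dExp a b) (1 - a2star a) (dataR a b) = -formP a b := by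
  rw [lam0_dataR]; unfold formP; ring

/-- The `ζ(3)`-coordinate of first-tale data vanishes (no double poles). -/
theorem lam2_dataR : lam2 (dataR a b) = 0 := by
  unfold lam2 dataR
  simp

end Summit.KontsevichZagierPeriods.Zeta5Search.FormalBarnes
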